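import Literature.NumberTheory.Automorphic.TorusOrbitalDescentProdCompactFactor   -- ★ C′₁ (F0P3b-p01 (g6)): `snd_eq_one_of_mem_prodBot` and the product-subgroup plumbing
import HarnessLib

/-!
# The Iwasawa integral over `(K₂ × K₁) × (N × 1) ≤ A × U` collapses to `K₂ × N` when `U` is abelian (Rogawski 1990 §4.13 p. 70; Gelbart 1975 Thm. 9.22 (iii))

Topic `NumberTheory/Automorphic`; namespace `Literature.NumberTheory.Automorphic`.  THEOREMS ONLY (no definition, no instance, no notation, no named fact, no `sorry`).
Cell `pub/hodgecm-mathlib`, line «CMCharIdentityTest» (F0P3b), desk F0P3b-plan (g12) PLAN v14 §10 brick S0 FILE 2′ «H-side canonical orbital integral» of (N-492)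
`stub_inducedCharTransfer` [Rogawski1990 Lemma 4.9.2]: the generic reshaping step of ★-to-be `UnitaryGroupTorusOrbitalIntegralCanonicalH` (seat B-p18 (g32)).
* **`integral_prod_prodBot_conj_eq_smul_integral_prod`** — on `A × U` with `U` ABELIAN, for measures `κ₂` on `K₂ ≤ A`, `κ₁` on `K₁ ≤ U`, `μ_N` on `N ≤ A` transported to the
  product subgroups `K₂ × K₁`, `N × 1` of `A × U` along the obvious topological isomorphisms `eK`, `eN`, every `x = (x₁, x₂)` and every measurable `F : A × U → ℂ`:
  `∫_{(K₂×K₁)×(N×1)} F(k (x n) k⁻¹) d((κ₂ ⊗ κ₁)_* ⊗ (μ_N)_*) = κ₁(K₁) • ∫_{K₂×N} F(k₂ (x₁ n₂) k₂⁻¹, x₂) d(κ₂ ⊗ μ_N)` (`k₁ x₂ k₁⁻¹ = x₂`; image measures and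
  `integral_map` — no integrability hypothesis).
HONEST LABEL: HC_CM is proved only modulo the printed citations (2 remaining named inputs hLiu418, h413) until rung 0 closes; this file pays no letter by itself.

## References
* [Rogawski1990] J. D. Rogawski, *Automorphic Representations of Unitary Groups in Three Variables* (1990), §4.13 p. 70; §4.9 p. 55.
* [Gelbart1975] S. Gelbart, *Automorphic Forms on Adele Groups* (1975), Thm. 9.22 (iii).
-/

set_option autoImplicit false

noncomputable section

open MeasureTheory Measure Set Filter Topology
open scoped ENNReal NNReal

namespace Literature.NumberTheory.Automorphic

open Literature.NumberTheory.Automorphic.TorusDescentProd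

/-! ## §1 Generic: the Iwasawa integral over `(K₂ × K₁) × (N × 1)` collapses to `K₂ × N` when `U` is abelian -/

section Generic

variable {A U : Type*} [Group A] [Group U] [TopologicalSpace A] [TopologicalSpace U] [IsTopologicalGroup A]
  [MeasurableSpace A] [BorelSpace A] [MeasurableSpace U] [BorelSpace U]
  [SecondCountableTopology A] [SecondCountableTopology U]
  {K₂ N : Subgroup A} {K₁ : Subgroup U}

/-- **The Iwasawa integral over `(K₂ × K₁) × (N × 1)` of a conjugate collapses to `K₂ × N`** when `U` is abelian: for measures `κ₂` on `K₂`, `κ₁` on `K₁`, `μ_N` on `N`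
transported to the product subgroups `K₂ × K₁ ≤ A × U`, `N × 1 ≤ A × U` along the obvious topological isomorphisms, every `x = (x₁, x₂) ∈ A × U` and every measurable `F`,
`∫_{(K₂×K₁)×(N×1)} F(k (x n) k⁻¹) = κ₁(K₁) • ∫_{K₂×N} F(k₂ (x₁ n₂) k₂⁻¹, x₂) d(κ₂ ⊗ μ_N)` (`k₁ x₂ k₁⁻¹ = x₂`; image measures and `integral_map`, no integrability).
[cite: Rogawski1990, §4.13 p. 70] [cite: Gelbart1975, Thm. 9.22 (iii)] -/
theorem integral_prod_prodBot_conj_eq_smul_integral_prod (hU : ∀ x y : U, x * y = y * x)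
    (eK : ↥K₂ × ↥K₁ ≃ₜ* ↥(K₂.prod K₁)) (heK : ∀ q, ((eK q : ↥(K₂.prod K₁)) : A × U) = ((q.1 : A), (q.2 : U)))
    (eN : ↥N ≃ₜ* ↥(N.prod (⊥ : Subgroup U))) (heN : ∀ n, ((eN n : ↥(N.prod (⊥ : Subgroup U))) : A × U) = ((n : A), 1))
    (κ₂ : Measure ↥K₂) [SigmaFinite κ₂] (κ₁ : Measure ↥K₁) [SigmaFinite κ₁] (μN : Measure ↥N) [SigmaFinite μN]
    (x : A × U) {F : A × U → ℂ} (hF : Measurable F) :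
    ∫ p : ↥(K₂.prod K₁) × ↥(N.prod (⊥ : Subgroup U)), F ((p.1 : A × U) * (x * (p.2 : A × U)) * (p.1 : A × U)⁻¹)
        ∂(((κ₂.prod κ₁).map eK).prod (μN.map eN)) =
      (κ₁ Set.univ).toReal • ∫ q : ↥K₂ × ↥N, F ((q.1 : A) * (x.1 * (q.2 : A)) * (q.1 : A)⁻¹, x.2) ∂(κ₂.prod μN) := by
  haveI : SecondCountableTopology ↥K₂ := TopologicalSpace.Subtype.secondCountableTopology _
  haveI : SecondCountableTopology ↥K₁ := TopologicalSpace.Subtype.secondCountableTopology _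
  haveI : SecondCountableTopology ↥N := TopologicalSpace.Subtype.secondCountableTopology _
  haveI : SecondCountableTopology ↥(K₂.prod K₁) := TopologicalSpace.Subtype.secondCountableTopology _
  haveI : SecondCountableTopology ↥(N.prod (⊥ : Subgroup U)) := TopologicalSpace.Subtype.secondCountableTopology _
  haveI : BorelSpace (↥K₂ × ↥K₁) := Prod.borelSpace
  haveI : BorelSpace (↥(K₂.prod K₁) × ↥(N.prod (⊥ : Subgroup U))) := Prod.borelSpace
  haveI : BorelSpace ((↥K₂ × ↥K₁) × ↥N) := Prod.borelSpace
  haveI : BorelSpace (↥K₂ × ↥N) := Prod.borelSpace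
  haveI : BorelSpace (A × U) := Prod.borelSpace
  -- `(κ₂ ⊗ κ₁).map eK ⊗ μN.map eN = ((κ₂ ⊗ κ₁) ⊗ μN).map (eK × eN)`
  have hmeas : (((κ₂.prod κ₁).map eK).prod (μN.map eN)) =
      ((κ₂.prod κ₁).prod μN).map (Prod.map eK eN) :=
    (Measure.map_prod_map _ _ eK.continuous.measurable eN.continuous.measurable)
  rw [hmeas]
  have hme : MeasurableEmbedding (Prod.map eK eN : (↥K₂ × ↥K₁) × ↥N → ↥(K₂.prod K₁) × ↥(N.prod (⊥ : Subgroup U))) :=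
    (eK.toHomeomorph.prodCongr eN.toHomeomorph).measurableEmbedding
  rw [hme.integral_map]
  -- the integrand in the coordinates `((k₂, k₁), n)`
  have hpt : ∀ q : (↥K₂ × ↥K₁) × ↥N,
      F (((Prod.map eK eN q).1 : A × U) * (x * ((Prod.map eK eN q).2 : A × U)) * ((Prod.map eK eN q).1 : A × U)⁻¹) =
        F (((q.1.1 : A) * (x.1 * (q.2 : A)) * (q.1.1 : A)⁻¹, x.2)) := by
    intro q
    rw [Prod.map_fst, Prod.map_snd, heK, heN]
    congr 1
    refine Prod.ext rfl ?_
    simp only [Prod.snd_mul, Prod.snd_inv, mul_one]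
    rw [hU (q.1.2 : U) x.2, mul_inv_cancel_right]
  simp only [hpt]
  -- project `((k₂, k₁), n) ↦ (k₂, n)`: the image of `(κ₂ ⊗ κ₁) ⊗ μN` is `κ₁(K₁) • (κ₂ ⊗ μN)`
  have hproj : Measurable fun q : (↥K₂ × ↥K₁) × ↥N => (q.1.1, q.2) := (measurable_fst.comp measurable_fst).prodMk measurable_snd
  have hG : Measurable fun r : ↥K₂ × ↥N => F (((r.1 : A) * (x.1 * (r.2 : A)) * (r.1 : A)⁻¹, x.2)) :=
    hF.comp (((((continuous_subtype_val.comp continuous_fst).mul (continuous_const.mul (continuous_subtype_val.comp continuous_snd))).mul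
      (continuous_subtype_val.comp continuous_fst).inv).prodMk continuous_const).measurable)
  have hmap : ((κ₂.prod κ₁).prod μN).map (fun q : (↥K₂ × ↥K₁) × ↥N => (q.1.1, q.2)) = (κ₁ Set.univ) • (κ₂.prod μN) := by
    have h1 : (fun q : (↥K₂ × ↥K₁) × ↥N => (q.1.1, q.2)) = Prod.map Prod.fst id := by
      funext q; rfl
    rw [h1, ← Measure.map_prod_map _ _ measurable_fst measurable_id, Measure.map_fst_prod, Measure.map_id, Measure.prod_smul_left]
  calc ∫ q : (↥K₂ × ↥K₁) × ↥N, F (((q.1.1 : A) * (x.1 * (q.2 : A)) * (q.1.1 : A)⁻¹, x.2)) ∂((κ₂.prod κ₁).prod μN)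
      = ∫ r : ↥K₂ × ↥N, F (((r.1 : A) * (x.1 * (r.2 : A)) * (r.1 : A)⁻¹, x.2)) ∂(((κ₂.prod κ₁).prod μN).map fun q : (↥K₂ × ↥K₁) × ↥N => (q.1.1, q.2)) := by
        rw [integral_map hproj.aemeasurable hG.aestronglyMeasurable]
    _ = (κ₁ Set.univ).toReal • ∫ q : ↥K₂ × ↥N, F ((q.1 : A) * (x.1 * (q.2 : A)) * (q.1 : A)⁻¹, x.2) ∂(κ₂.prod μN) := by
        rw [hmap, integral_smul_measure, ENNReal.toReal]

end Generic

end Literature.NumberTheory.Automorphic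

end
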